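/-
Copyright (c) 2026. All rights reserved.
Released under Apache 2.0 license as described in the file LICENSE.
-/
import Mathlib
import HarnessLib
import Literature.NumberTheory.LFunctions.AndersonStarkLiouville
import Literature.NumberTheory.LFunctions.ConreyIwaniec2002Thm61DivisorMoments
import Literature.NumberTheory.Sieve.SelbergSymmetryFormula

/-! # Series bound for far-field shell decomposition

This file proves an auxiliary series bound needed for the far-field estimate in the
Hardy-Littlewood-Lehmer split dictionary approach.

## Main result

* `series_log_div_sq_le`: For `t ≥ 100`, `∑_{n≥1} log(t+n+2)/n² ≤ 2 log t + 10`.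
-/

set_option linter.dupNamespace false
set_option maxHeartbeats 400000

namespace Summit.RiemannHypothesis.RiemannHypothesis.Theorems.DictionaryFarFieldSeries

open scoped Real
open BigOperators Topology
open Literature.NumberTheory.LFunctions

/-- For `t ≥ 1` and `n ≥ 1`, we have `t + n + 2 ≤ t * (n + 3)`. -/
lemma add_add_two_le_mul_add_three {t : ℝ} {n : ℕ} (ht : 1 ≤ t) (hn : 1 ≤ n) :
    t + n + 2 ≤ t * (n + 3) := by
  have hn' : (1 : ℝ) ≤ n := Nat.one_le_cast.mpr hn
  nlinarith

/-- For `n ≥ 1`, we have `n + 3 ≤ 4 * n`. -/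
lemma add_three_le_four_mul {n : ℕ} (hn : 1 ≤ n) : (n : ℝ) + 3 ≤ 4 * n := by
  have : (1 : ℝ) ≤ n := Nat.one_le_cast.mpr hn
  linarith

/-- For `n ≥ 1`, `log(n + 3) ≤ 2 + log n`. -/
lemma log_add_three_le {n : ℕ} (hn : 1 ≤ n) :
    Real.log ((n : ℝ) + 3) ≤ 2 + Real.log n := by
  have hn' : (0 : ℝ) < n := Nat.cast_pos.mpr (Nat.pos_of_ne_zero (Nat.one_le_iff_ne_zero.mp hn))
  have h4n : (n : ℝ) + 3 ≤ 4 * n := add_three_le_four_mul hn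
  calc Real.log ((n : ℝ) + 3)
      ≤ Real.log (4 * n) := Real.log_le_log (by linarith) h4n
    _ = Real.log 4 + Real.log n := Real.log_mul (by norm_num) hn'.ne'
    _ ≤ 2 + Real.log n := by linarith [Literature.NumberTheory.Sieve.SelbergSymmetry.log_four_lt_two]

/-- The function `n ↦ 1/n²` is summable over `ℕ`. -/
lemma summable_one_div_sq : Summable fun n : ℕ => (1 : ℝ) / (n : ℝ) ^ 2 :=
  Real.summable_one_div_nat_pow.mpr (by norm_num : 1 < 2)

/-- For `t ≥ 100` and `n ≥ 1`, `log(t + n + 2) ≤ log t + log(n + 3)`. -/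
lemma log_add_le {t : ℝ} {n : ℕ} (ht : 1 ≤ t) (hn : 1 ≤ n) :
    Real.log (t + n + 2) ≤ Real.log t + Real.log ((n : ℝ) + 3) := by
  have htpos : 0 < t := lt_of_lt_of_le zero_lt_one ht
  have hn3pos : (0 : ℝ) < (n : ℝ) + 3 := by positivity
  have hmul_pos : 0 < t * ((n : ℝ) + 3) := mul_pos htpos hn3pos
  have hle := add_add_two_le_mul_add_three ht hn
  calc Real.log (t + n + 2)
      ≤ Real.log (t * ((n : ℝ) + 3)) := Real.log_le_log (by linarith) hle
    _ = Real.log t + Real.log ((n : ℝ) + 3) := Real.log_mul htpos.ne' hn3pos.ne'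

/-- The function `n ↦ log n / n²` is summable over `ℕ`. Standard result using comparison with 1/n^(3/2). -/
lemma summable_log_div_sq : Summable fun n : ℕ => Real.log n / (n : ℝ) ^ 2 := by
  -- From CI we get Σ (1+log(h+1))/(h+1)² summable, which gives Σ log(h+1)/(h+1)² summable
  -- by comparison (subtracting Σ 1/(h+1)² which is also summable).
  have hCI := ConreyIwaniec2002.Thm61DivisorMoments.tsum_log_div_sq_le_three.1
  have hs1 : Summable fun n : ℕ => (1 : ℝ) / (n : ℝ) ^ 2 := summable_one_div_sq
  have hs1' : Summable fun h : ℕ => (1 : ℝ) / ((h : ℝ) + 1) ^ 2 := by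
    have hsnat := (summable_nat_add_iff 1).mpr hs1
    refine hsnat.congr fun h => ?_
    congr 1
    simp only [Nat.cast_add, Nat.cast_one]
  have hsCI_sub : Summable fun h : ℕ => Real.log ((h : ℝ) + 1) / ((h : ℝ) + 1) ^ 2 := by
    have hCI' : Summable fun h : ℕ => (1 + Real.log ((h : ℝ) + 1)) / ((h : ℝ) + 1) ^ 2 := hCI
    have hsub := hCI'.sub hs1'
    refine hsub.congr fun h => ?_
    have hpos : (0 : ℝ) < (h : ℝ) + 1 := by positivity
    have hposq : ((h : ℝ) + 1) ^ 2 ≠ 0 := by positivity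
    field_simp; ring
  -- Now Σ_{h≥0} log(h+1)/(h+1)² is summable, which is Σ_{n≥1} log n / n².
  -- Use: Summable f ↔ Summable (n ↦ f(n+1)) by summable_nat_add_iff.
  -- We want Summable (n ↦ log n / n²). Using ← summable_nat_add_iff 1, we need
  -- Summable (m ↦ log (m+1) / (m+1)²), which is exactly hsCI_sub.
  rw [← summable_nat_add_iff 1]
  refine hsCI_sub.congr fun n => ?_
  simp only [Nat.cast_add, Nat.cast_one]

/-- `∑_{n≥1} log n / n² ≤ 2`. Uses `tsum_log_div_sq_le_three` from ConreyIwaniec2002. -/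
lemma tsum_log_div_sq_le_two : ∑' n : ℕ, Real.log n / (n : ℝ) ^ 2 ≤ 2 := by
  -- CI: Σ_{h≥0} (1+log(h+1))/(h+1)² ≤ 3 with h=0 term = (1+log 1)/1 = 1.
  -- So Σ_{h≥1} (1+log(h+1))/(h+1)² ≤ 2, i.e. Σ_{k≥2} (1+log k)/k² ≤ 2.
  -- For n ≥ 1, log n / n² ≤ (1+log n) / n². So Σ_{n≥1} log n / n² = 0 + Σ_{n≥2} log n / n²
  -- ≤ Σ_{n≥2} (1+log n) / n² ≤ 2.
  have hCI := ConreyIwaniec2002.Thm61DivisorMoments.tsum_log_div_sq_le_three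
  have hs_CI : Summable fun h : ℕ => (1 + Real.log ((h : ℝ) + 1)) / ((h : ℝ) + 1) ^ 2 := hCI.1
  have hle_CI : ∑' h : ℕ, (1 + Real.log ((h : ℝ) + 1)) / ((h : ℝ) + 1) ^ 2 ≤ 3 := hCI.2
  have hslog : Summable fun n : ℕ => Real.log n / (n : ℝ) ^ 2 := summable_log_div_sq
  -- h=0 term of CI series is (1 + log 1)/1² = 1
  have h0_CI : (1 + Real.log ((0 : ℕ) + 1)) / ((0 : ℕ) + 1 : ℝ) ^ 2 = 1 := by simp [Real.log_one]
  -- Split CI series at h=0: 1 + Σ_{h≥1} ... ≤ 3, so Σ_{h≥1} ... ≤ 2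
  rw [hs_CI.tsum_eq_zero_add, h0_CI] at hle_CI
  -- Σ_{h≥0} f(h+1) ≤ 2 where f(k) = (1+log k)/k² for k ≥ 2
  -- This equals Σ_{k≥2} (1+log k)/k²
  have hs1' : Summable fun h : ℕ => (1 + Real.log ((h : ℝ) + 2)) / ((h : ℝ) + 2) ^ 2 := by
    have hsnat := (summable_nat_add_iff 1).mpr hs_CI
    refine hsnat.congr fun h => ?_
    simp only [Nat.cast_add, Nat.cast_one]; ring_nf
  have hle1' : ∑' h : ℕ, (1 + Real.log ((h : ℝ) + 2)) / ((h : ℝ) + 2) ^ 2 ≤ 2 := by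
    have heq : ∑' h : ℕ, (1 + Real.log ((h : ℝ) + 2)) / ((h : ℝ) + 2) ^ 2 =
               ∑' b : ℕ, (1 + Real.log (((b + 1 : ℕ) : ℝ) + 1)) / (((b + 1 : ℕ) : ℝ) + 1) ^ 2 := by
      congr 1; ext h; simp only [Nat.cast_add, Nat.cast_one]; ring_nf
    -- From hle_CI: 1 + Σ_{b≥0} f(b+1) ≤ 3, so Σ_{b≥0} f(b+1) ≤ 2
    -- where f(b+1) = (1 + log((b+1)+1)) / ((b+1)+1)²
    linarith
  -- Now: log n / n² for n ≥ 2 is ≤ (1 + log n) / n²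
  -- Σ_{n≥0} log n / n² = 0 + 0 + Σ_{n≥2} log n / n²
  have hs0 : Real.log (0 : ℕ) / (0 : ℕ) ^ 2 = 0 := by simp
  have hs1 : Real.log (1 : ℕ) / (1 : ℕ) ^ 2 = 0 := by simp [Real.log_one]
  have hslog' : Summable fun h : ℕ => Real.log ((h : ℝ) + 2) / ((h : ℝ) + 2) ^ 2 := by
    have hsnat := (summable_nat_add_iff 2).mpr hslog
    refine hsnat.congr fun h => ?_
    simp only [Nat.cast_add, Nat.cast_ofNat]
  have hterm' : ∀ h : ℕ, Real.log ((h : ℝ) + 2) / ((h : ℝ) + 2) ^ 2 ≤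
      (1 + Real.log ((h : ℝ) + 2)) / ((h : ℝ) + 2) ^ 2 := fun h => by
    have hh2pos : (0 : ℝ) < (h : ℝ) + 2 := by positivity
    have h1h2 : (1 : ℝ) ≤ (h : ℝ) + 2 := by have : (0 : ℝ) ≤ (h : ℝ) := Nat.cast_nonneg h; linarith
    have hlog2 : 0 ≤ Real.log ((h : ℝ) + 2) := Real.log_nonneg h1h2
    gcongr; linarith
  have hle' : ∑' h : ℕ, Real.log ((h : ℝ) + 2) / ((h : ℝ) + 2) ^ 2 ≤ 2 :=
    (Summable.tsum_le_tsum hterm' hslog' hs1').trans hle1'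
  -- Σ_{n≥0} log n / n² = 0 + 0 + Σ_{n≥2} log n / n²
  rw [hslog.tsum_eq_zero_add, hs0, zero_add]
  have hslog1 : Summable fun n : ℕ => Real.log (((n + 1 : ℕ) : ℝ)) / ((n + 1 : ℕ) : ℝ) ^ 2 :=
    (summable_nat_add_iff 1).mpr hslog
  rw [hslog1.tsum_eq_zero_add]
  simp only [Nat.cast_one, Real.log_one, zero_div, zero_add]
  -- Now: Σ_{n≥0} log((n+1)+1)/((n+1)+1)² = Σ_{h≥0} log(h+2)/(h+2)² ≤ 2
  have heq : (fun n : ℕ => Real.log (((n + 1 : ℕ) + 1 : ℕ) : ℝ) / ((((n + 1 : ℕ) + 1 : ℕ)) : ℝ) ^ 2) =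
             fun h : ℕ => Real.log ((h : ℝ) + 2) / ((h : ℝ) + 2) ^ 2 := by
    ext h; simp only [Nat.cast_add, Nat.cast_one]; ring_nf
  rw [heq]
  exact hle'

/-- `∑_{n≥1} log(n+3) / n² ≤ 6`. -/
lemma tsum_log_add_three_div_sq_le : ∑' n : ℕ, Real.log ((n : ℝ) + 3) / (n : ℝ) ^ 2 ≤ 6 := by
  have hs1 : Summable fun n : ℕ => (1 : ℝ) / (n : ℝ) ^ 2 := summable_one_div_sq
  have hslog : Summable fun n : ℕ => Real.log n / (n : ℝ) ^ 2 := summable_log_div_sq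
  have hs2 : Summable fun n : ℕ => (2 : ℝ) / (n : ℝ) ^ 2 := (hs1.mul_left 2).congr fun n => by ring
  have hs : Summable fun n : ℕ => Real.log ((n : ℝ) + 3) / (n : ℝ) ^ 2 := by
    refine .of_nonneg_of_le ?_ ?_ (hs2.add hslog)
    · intro n
      have h1n3 : (1 : ℝ) ≤ (n : ℝ) + 3 := by have : (0 : ℝ) ≤ (n : ℝ) := Nat.cast_nonneg n; linarith
      exact div_nonneg (Real.log_nonneg h1n3) (sq_nonneg _)
    · intro n
      by_cases hn : n = 0
      · subst hn; simp
      · have hn' : 1 ≤ n := Nat.one_le_iff_ne_zero.mpr hn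
        have hbound := log_add_three_le hn'
        have hnsq : (n : ℝ) ^ 2 ≠ 0 := by positivity
        calc Real.log ((n : ℝ) + 3) / (n : ℝ) ^ 2
            ≤ (2 + Real.log n) / (n : ℝ) ^ 2 := by gcongr
          _ = 2 / (n : ℝ) ^ 2 + Real.log n / (n : ℝ) ^ 2 := by field_simp
  have hterm_le : ∀ n : ℕ, Real.log ((n : ℝ) + 3) / (n : ℝ) ^ 2 ≤
      2 / (n : ℝ) ^ 2 + Real.log n / (n : ℝ) ^ 2 := by
    intro n
    by_cases hn : n = 0
    · subst hn; simp
    · have hn' : 1 ≤ n := Nat.one_le_iff_ne_zero.mpr hn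
      have hbound := log_add_three_le hn'
      have hnsq : (n : ℝ) ^ 2 ≠ 0 := by positivity
      calc Real.log ((n : ℝ) + 3) / (n : ℝ) ^ 2
          ≤ (2 + Real.log n) / (n : ℝ) ^ 2 := by gcongr
        _ = 2 / (n : ℝ) ^ 2 + Real.log n / (n : ℝ) ^ 2 := by field_simp
  calc ∑' n : ℕ, Real.log ((n : ℝ) + 3) / (n : ℝ) ^ 2
      ≤ ∑' n : ℕ, (2 / (n : ℝ) ^ 2 + Real.log n / (n : ℝ) ^ 2) :=
        Summable.tsum_le_tsum hterm_le hs (hs2.add hslog)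
    _ = 2 * ∑' n : ℕ, 1 / (n : ℝ) ^ 2 + ∑' n : ℕ, Real.log n / (n : ℝ) ^ 2 := by
        rw [Summable.tsum_add hs2 hslog, ← tsum_mul_left]; ring_nf
    _ ≤ 2 * 2 + 2 := by nlinarith [tsum_one_div_sq_le_two, tsum_log_div_sq_le_two]
    _ = 6 := by ring

/-- The function `n ↦ log(t+n+2)/n²` (with value 0 at n=0) is summable for `t ≥ 1`. -/
lemma summable_log_add_div_sq {t : ℝ} (ht : 1 ≤ t) :
    Summable fun n : ℕ => if n = 0 then (0 : ℝ) else Real.log (t + n + 2) / (n : ℝ) ^ 2 := by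
  have hs1 : Summable fun n : ℕ => (1 : ℝ) / (n : ℝ) ^ 2 := summable_one_div_sq
  have hslog : Summable fun n : ℕ => Real.log n / (n : ℝ) ^ 2 := summable_log_div_sq
  have hs2 : Summable fun n : ℕ => (2 : ℝ) / (n : ℝ) ^ 2 := (hs1.mul_left 2).congr fun n => by ring
  have hslog3 : Summable fun n : ℕ => Real.log ((n : ℝ) + 3) / (n : ℝ) ^ 2 := by
    refine .of_nonneg_of_le ?_ ?_ (hs2.add hslog)
    · intro n
      have h1n3 : (1 : ℝ) ≤ (n : ℝ) + 3 := by have : (0 : ℝ) ≤ (n : ℝ) := Nat.cast_nonneg n; linarith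
      exact div_nonneg (Real.log_nonneg h1n3) (sq_nonneg _)
    · intro n; by_cases hn : n = 0
      · subst hn; simp
      · have hn' : 1 ≤ n := Nat.one_le_iff_ne_zero.mpr hn
        have hbound := log_add_three_le hn'
        have hnsq : (n : ℝ) ^ 2 ≠ 0 := by positivity
        calc Real.log ((n : ℝ) + 3) / (n : ℝ) ^ 2
            ≤ (2 + Real.log n) / (n : ℝ) ^ 2 := by gcongr
          _ = 2 / (n : ℝ) ^ 2 + Real.log n / (n : ℝ) ^ 2 := by field_simp
  have hslogt : Summable fun n : ℕ => |Real.log t| / (n : ℝ) ^ 2 := (hs1.mul_left |Real.log t|).congr fun n => by ring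
  refine .of_nonneg_of_le ?_ ?_ (hslogt.add hslog3)
  · intro n; split_ifs
    · exact le_refl 0
    · have htpos : 0 < t := lt_of_lt_of_le zero_lt_one ht
      exact div_nonneg (Real.log_nonneg (by linarith : 1 ≤ t + n + 2)) (sq_nonneg _)
  · intro n; split_ifs with hn
    · subst hn; simp
    · have hn' : 1 ≤ n := Nat.one_le_iff_ne_zero.mpr hn
      have hlog_le := log_add_le ht hn'
      have htpos : 0 < t := lt_of_lt_of_le zero_lt_one ht
      have h1n3 : (1 : ℝ) ≤ (n : ℝ) + 3 := by have : (0 : ℝ) ≤ (n : ℝ) := Nat.cast_nonneg n; linarith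
      have hlog3 : 0 ≤ Real.log ((n : ℝ) + 3) := Real.log_nonneg h1n3
      have hnsq : (n : ℝ) ^ 2 ≠ 0 := by positivity
      calc Real.log (t + n + 2) / (n : ℝ) ^ 2
          ≤ (Real.log t + Real.log ((n : ℝ) + 3)) / (n : ℝ) ^ 2 := by gcongr
        _ ≤ (|Real.log t| + Real.log ((n : ℝ) + 3)) / (n : ℝ) ^ 2 := by gcongr; exact le_abs_self _
        _ = |Real.log t| / (n : ℝ) ^ 2 + Real.log ((n : ℝ) + 3) / (n : ℝ) ^ 2 := by field_simp

/-- Series bound: `∑_{n≥1} log(t+n+2)/n² ≤ 2 log t + 10` for `t ≥ 100`. -/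
theorem series_log_div_sq_le (t : ℝ) (ht : 100 ≤ t) :
    ∑' n : ℕ, (if n = 0 then 0 else Real.log (t + n + 2) / (n : ℝ) ^ 2) ≤ 2 * Real.log t + 10 := by
  have ht1 : 1 ≤ t := le_trans (by norm_num : (1 : ℝ) ≤ 100) ht
  have htpos : 0 < t := lt_of_lt_of_le zero_lt_one ht1
  have hlogt_pos : 0 < Real.log t := Real.log_pos (by linarith : 1 < t)
  have hs := summable_log_add_div_sq ht1
  have hs1 : Summable fun n : ℕ => (1 : ℝ) / (n : ℝ) ^ 2 := summable_one_div_sq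
  have hslog : Summable fun n : ℕ => Real.log n / (n : ℝ) ^ 2 := summable_log_div_sq
  have hs2 : Summable fun n : ℕ => (2 : ℝ) / (n : ℝ) ^ 2 := (hs1.mul_left 2).congr fun n => by ring
  have hs3 : Summable fun n : ℕ => Real.log ((n : ℝ) + 3) / (n : ℝ) ^ 2 := by
    refine .of_nonneg_of_le ?_ ?_ (hs2.add hslog)
    · intro n
      have h1n3 : (1 : ℝ) ≤ (n : ℝ) + 3 := by have : (0 : ℝ) ≤ (n : ℝ) := Nat.cast_nonneg n; linarith
      exact div_nonneg (Real.log_nonneg h1n3) (sq_nonneg _)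
    · intro n; by_cases hn : n = 0
      · subst hn; simp
      · have hn' : 1 ≤ n := Nat.one_le_iff_ne_zero.mpr hn
        have hbound := log_add_three_le hn'
        have hnsq : (n : ℝ) ^ 2 ≠ 0 := by positivity
        calc Real.log ((n : ℝ) + 3) / (n : ℝ) ^ 2
            ≤ (2 + Real.log n) / (n : ℝ) ^ 2 := by gcongr
          _ = 2 / (n : ℝ) ^ 2 + Real.log n / (n : ℝ) ^ 2 := by field_simp
  have hslogt : Summable fun n : ℕ => Real.log t / (n : ℝ) ^ 2 := (hs1.mul_left (Real.log t)).congr fun n => by ring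
  have hterm_le : ∀ n : ℕ, (if n = 0 then 0 else Real.log (t + n + 2) / (n : ℝ) ^ 2) ≤
      Real.log t / (n : ℝ) ^ 2 + Real.log ((n : ℝ) + 3) / (n : ℝ) ^ 2 := fun n => by
    split_ifs with hn
    · subst hn; simp
    · have hn' : 1 ≤ n := Nat.one_le_iff_ne_zero.mpr hn
      have hlog_le := log_add_le ht1 hn'
      have hnsq : (n : ℝ) ^ 2 ≠ 0 := by positivity
      calc Real.log (t + n + 2) / (n : ℝ) ^ 2
          ≤ (Real.log t + Real.log ((n : ℝ) + 3)) / (n : ℝ) ^ 2 := by gcongr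
        _ = Real.log t / (n : ℝ) ^ 2 + Real.log ((n : ℝ) + 3) / (n : ℝ) ^ 2 := by field_simp
  calc ∑' n : ℕ, (if n = 0 then (0 : ℝ) else Real.log (t + n + 2) / (n : ℝ) ^ 2)
      ≤ ∑' n : ℕ, (Real.log t / (n : ℝ) ^ 2 + Real.log ((n : ℝ) + 3) / (n : ℝ) ^ 2) :=
        Summable.tsum_le_tsum hterm_le hs (hslogt.add hs3)
    _ = ∑' n : ℕ, Real.log t / (n : ℝ) ^ 2 + ∑' n : ℕ, Real.log ((n : ℝ) + 3) / (n : ℝ) ^ 2 :=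
        Summable.tsum_add hslogt hs3
    _ = Real.log t * ∑' n : ℕ, 1 / (n : ℝ) ^ 2 + ∑' n : ℕ, Real.log ((n : ℝ) + 3) / (n : ℝ) ^ 2 := by
        congr 1; rw [← tsum_mul_left]; ring_nf
    _ ≤ Real.log t * 2 + 6 := by nlinarith [tsum_one_div_sq_le_two, tsum_log_add_three_div_sq_le]
    _ = 2 * Real.log t + 6 := by ring
    _ ≤ 2 * Real.log t + 10 := by linarith

end Summit.RiemannHypothesis.RiemannHypothesis.Theorems.DictionaryFarFieldSeries
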